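import Literature.MathematicalPhysics.QuantumLattice.DWaveOrderParameterSymmetricRange
import Literature.MathematicalPhysics.QuantumLattice.InfVolFermionStateGaugeAction
import HarnessLib

/-!
# The conjugate densities of the translation-invariant ground states of a pencil FILL the interval of
# one-sided derivatives; at a field `h` the pair amplitudes of the sourced `t–t'` ground states fill
# `[−∂⁻E(h), −∂⁺E(h)]`

Topic `Literature/MathematicalPhysics/QuantumLattice` (namespace = path; family `hubbard`). Sequel of
`MeanEnergyMinimiserConjugateRange.lean` (hubbard-cq-p5: RANGE `∂⁺e₀(σ) ≤ e_{Ψ₁}(ω) ≤ ∂⁻e₀(σ)` for every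
minimiser `ω` of the mean energy of the pencil `Ψ₀ + σΨ₁`, both endpoints ATTAINED) and of
`DWaveOrderParameterInfiniteVolume.lean` §3 (the `d`-wave reading at field `h`). The missing sentence of the
finite-`h` column of the Koma–Tasaki dictionary of the Hubbard cuprate cell (`hubbard-cq`, DICTIONARY §12 (r1),
"at a kink the minimisers fill the interval"): the minimisers form a CONVEX set (a face of the
translation-invariant states, `IsMeanEnergyMinimiser.mix`) and the conjugate density is AFFINE, so every value
between the two attained endpoints is attained — the image is EXACTLY the closed interval. Everything is PROVED;
no definition, no named fact, zero compute.

* `FermionInteraction.image_meanEnergy_minimisers_pencil_eq_Icc` (model-free): for every even pencil on `ℤ^d`,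
  `{e_{Ψ₁}(ω) : ω minimiser of Ψ₀ + σΨ₁} = [∂⁺e₀(σ), ∂⁻e₀(σ)]`.
* `image_two_mul_re_expect_localPairAt_minimisers_eq_Icc` (`d`-wave, `t–t'`, any real field `h`):
  `{2 Re ω(P₀^d) : ω TI ground state of Ψ_h} = [−∂⁻E(h), −∂⁺E(h)]`, `E = dWaveSourceEnergyDensityTT' t' U μ`,
  `Ψ_h = hubbardTTPrimeSourcedInteraction 1 t' U μ dWaveFormFactor h`; hence the pair amplitudes themselves fill
  `[−∂⁻E(h)/2, −∂⁺E(h)/2]` (`image_re_expect_localPairAt_minimisers_eq_Icc`) and every value in that interval is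
  the pair amplitude of some translation-invariant ground state (`exists_isMeanEnergyMinimiser_re_expect_localPairAt_eq`).
  At `h = 0` the interval is `[−m⋆, m⋆]`, `m⋆ = dWaveOrderParameterTT' t' U μ`
  (`image_re_expect_localPairAt_minimisers_zero_eq_Icc`, via hubbard-cq-p5's symmetric kink
  `leftDeriv_dWaveSourceEnergyDensityTT'_zero`; the full complex picture there is the disc theorem
  `image_expect_localPairAt_groundStates_eq_closedBall` of `DWaveSymmetricGroundStateLRO.lean`).

HONEST SCOPE: statements about INFINITE-VOLUME translation-invariant ground states; a kink of `E` at `h > 0`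
(first-order line in the field) is neither asserted nor excluded anywhere; nothing here bears on `d`-wave order.

## References
* R. B. Israel, *Convexity in the Theory of Lattice Gases* (1979), §II.1 eq. (1)–(2) (invariant equilibrium
  states = tangent functionals; the set of tangents at a point is the full subdifferential).
  [cite: Israel1979, §II.1 eq. (1)–(2)]
* R. B. Griffiths, Phys. Rev. 152 (1966) 240, §II. [cite: Griffiths1966, §II]
* T. Koma, H. Tasaki, J. Stat. Phys. 76 (1994) 745, §1. [cite: KomaTasaki1994, §1]
-/

noncomputable section

namespace Literature.MathematicalPhysics.QuantumLattice

open _root_.Matrix Finset HubbardWave0 Literature.Probability.LatticeModels _root_.Filter Set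
open scoped _root_.Topology

variable {d : ℕ}

/-! ### Model-free: the conjugate densities of the minimisers of a pencil fill the interval -/

namespace FermionInteraction

/-- **Affine values on a convex set fill the segment between two attained values**: if `ω₁, ω₂` are
minimisers of `Ψ` with conjugate densities `b₁ ≤ b ≤ b₂`, some minimiser (a mixture of the two) has conjugate
density exactly `b`. [cite: Israel1979, §II.1 eq. (1)–(2)] -/
theorem exists_isMeanEnergyMinimiser_meanEnergy_eq_of_mem_Icc {Ψ Φ : FermionInteraction d} {R R' : ℝ}
    {ω₁ ω₂ : InfVolFermionState d} (h₁ : ω₁.IsMeanEnergyMinimiser Ψ R) (h₂ : ω₂.IsMeanEnergyMinimiser Ψ R)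
    {b : ℝ} (hb : b ∈ Icc (ω₁.meanEnergy Φ R') (ω₂.meanEnergy Φ R')) :
    ∃ ω : InfVolFermionState d, ω.IsMeanEnergyMinimiser Ψ R ∧ ω.meanEnergy Φ R' = b := by
  set b₁ := ω₁.meanEnergy Φ R' with hb₁
  set b₂ := ω₂.meanEnergy Φ R' with hb₂
  rcases eq_or_lt_of_le (hb.1.trans hb.2) with heq | hlt
  · -- degenerate segment: `b = b₁`
    exact ⟨ω₁, h₁, by rw [← hb₁]; linarith [hb.1, hb.2]⟩
  · -- `t = (b₂ − b)/(b₂ − b₁) ∈ [0,1]`, `t b₁ + (1 − t) b₂ = b`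
    have hden : 0 < b₂ - b₁ := sub_pos.2 hlt
    set t : ℝ := (b₂ - b) / (b₂ - b₁) with ht
    have ht₀ : 0 ≤ t := div_nonneg (sub_nonneg.2 hb.2) hden.le
    have ht₁ : t ≤ 1 := by
      rw [ht, div_le_one hden]
      linarith [hb.1]
    refine ⟨InfVolFermionState.mix t ht₀ ht₁ ω₁ ω₂, h₁.mix h₂ t ht₀ ht₁, ?_⟩
    rw [InfVolFermionState.meanEnergy_mix, ← hb₁, ← hb₂, ht]
    field_simp
    ring

variable (Ψ₀ Ψ₁ : FermionInteraction d) (R : ℝ)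

/-- **THE INTERVAL THEOREM (model-free)**: the conjugate densities `e_{Ψ₁}(ω)` of the translation-invariant
ground states `ω` of the pencil `Ψ₀ + σΨ₁` FILL EXACTLY the interval `[∂⁺e₀(σ), ∂⁻e₀(σ)]` of one-sided
derivatives of the ground-state energy density `e₀(s) = tiGroundEnergyDensity (Ψ₀ + sΨ₁) R` — range
(`rightDeriv_le_meanEnergy`, `meanEnergy_le_leftDeriv`), attained endpoints
(`exists_isMeanEnergyMinimiser_meanEnergy_eq_rightDeriv/leftDeriv`), convexity of the minimisers.
[cite: Israel1979, §II.1 eq. (1)–(2)] -/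
theorem image_meanEnergy_minimisers_pencil_eq_Icc (σ : ℝ) :
    (fun ω : InfVolFermionState d => ω.meanEnergy Ψ₁ R) '' {ω | ω.IsMeanEnergyMinimiser (pencil Ψ₀ Ψ₁ σ) R} =
      Icc (derivWithin (fun s => (pencil Ψ₀ Ψ₁ s).tiGroundEnergyDensity R) (Ioi σ) σ)
        (derivWithin (fun s => (pencil Ψ₀ Ψ₁ s).tiGroundEnergyDensity R) (Iio σ) σ) := by
  ext b
  constructor
  · rintro ⟨ω, hω, rfl⟩
    exact ⟨hω.rightDeriv_le_meanEnergy, hω.meanEnergy_le_leftDeriv⟩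
  · intro hb
    obtain ⟨ω₁, hω₁, he₁⟩ := exists_isMeanEnergyMinimiser_meanEnergy_eq_rightDeriv Ψ₀ Ψ₁ R σ
    obtain ⟨ω₂, hω₂, he₂⟩ := exists_isMeanEnergyMinimiser_meanEnergy_eq_leftDeriv Ψ₀ Ψ₁ R σ
    rw [← he₁, ← he₂] at hb
    obtain ⟨ω, hω, hωb⟩ := exists_isMeanEnergyMinimiser_meanEnergy_eq_of_mem_Icc (R' := R) hω₁ hω₂ hb
    exact ⟨ω, hω, hωb⟩

/-- Pointwise form: every `b ∈ [∂⁺e₀(σ), ∂⁻e₀(σ)]` is the conjugate density of some translation-invariant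
ground state of `Ψ₀ + σΨ₁`. [cite: Israel1979, §II.1 eq. (1)–(2)] -/
theorem exists_isMeanEnergyMinimiser_pencil_meanEnergy_eq {σ b : ℝ}
    (hb : b ∈ Icc (derivWithin (fun s => (pencil Ψ₀ Ψ₁ s).tiGroundEnergyDensity R) (Ioi σ) σ)
      (derivWithin (fun s => (pencil Ψ₀ Ψ₁ s).tiGroundEnergyDensity R) (Iio σ) σ)) :
    ∃ ω : InfVolFermionState d, ω.IsMeanEnergyMinimiser (pencil Ψ₀ Ψ₁ σ) R ∧ ω.meanEnergy Ψ₁ R = b := by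
  have h := (image_meanEnergy_minimisers_pencil_eq_Icc Ψ₀ Ψ₁ R σ).symm.subset hb
  obtain ⟨ω, hω, hωb⟩ := h
  exact ⟨ω, hω, hωb⟩

end FermionInteraction

/-! ### The `d`-wave pair amplitude at field `h` -/

section DWave

variable (t' U μ h : ℝ)

/-- **THE INTERVAL THEOREM AT FIELD `h`** (any real `h`): the induced pair amplitudes `2 Re ω(P₀^d)` of the
translation-invariant ground states of the sourced `t–t'` interaction `Ψ_h` FILL EXACTLY
`[−∂⁻E(h), −∂⁺E(h)]`, `E = dWaveSourceEnergyDensityTT' t' U μ` — at a kink of `E` (a first-order line in the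
field) the coexisting ground states realise every intermediate amplitude. [cite: Griffiths1966, §II] -/
theorem image_two_mul_re_expect_localPairAt_minimisers_eq_Icc :
    (fun ω : InfVolFermionState 2 => 2 * (ω.expect (pairRegion (insert (0 : Site 2) unitSteps) 0)
        (localPairAt (insert 0 unitSteps) dWaveFormFactor 0)).re) ''
        {ω | ω.IsMeanEnergyMinimiser (hubbardTTPrimeSourcedInteraction 1 t' U μ dWaveFormFactor h) 1} =
      Icc (-derivWithin (dWaveSourceEnergyDensityTT' t' U μ) (Iio h) h)
        (-derivWithin (dWaveSourceEnergyDensityTT' t' U μ) (Ioi h) h) := by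
  have key := FermionInteraction.image_meanEnergy_minimisers_pencil_eq_Icc
    (hubbardTTPrimeMuInteraction 1 t' U μ) (pairSourceInteraction dWaveFormFactor) 1 (-h)
  rw [rightDeriv_pencil_dWave_eq, leftDeriv_pencil_dWave_eq] at key
  rw [← key]
  unfold hubbardTTPrimeSourcedInteraction
  refine Set.image_congr fun ω _ => ?_
  rw [InfVolFermionState.meanEnergy_pairSourceInteraction_dWave_eq]

/-- The pair amplitudes themselves: `{Re ω(P₀^d) : ω TI ground state of Ψ_h} = [−∂⁻E(h)/2, −∂⁺E(h)/2]`.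
[cite: Griffiths1966, §II] -/
theorem image_re_expect_localPairAt_minimisers_eq_Icc :
    (fun ω : InfVolFermionState 2 => (ω.expect (pairRegion (insert (0 : Site 2) unitSteps) 0)
        (localPairAt (insert 0 unitSteps) dWaveFormFactor 0)).re) ''
        {ω | ω.IsMeanEnergyMinimiser (hubbardTTPrimeSourcedInteraction 1 t' U μ dWaveFormFactor h) 1} =
      Icc (-derivWithin (dWaveSourceEnergyDensityTT' t' U μ) (Iio h) h / 2)
        (-derivWithin (dWaveSourceEnergyDensityTT' t' U μ) (Ioi h) h / 2) := by
  have key := image_two_mul_re_expect_localPairAt_minimisers_eq_Icc t' U μ h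
  ext a
  constructor
  · rintro ⟨ω, hω, rfl⟩
    have hmem : 2 * (ω.expect (pairRegion (insert (0 : Site 2) unitSteps) 0)
        (localPairAt (insert 0 unitSteps) dWaveFormFactor 0)).re ∈ _ := key.subset ⟨ω, hω, rfl⟩
    exact ⟨by linarith [hmem.1], by linarith [hmem.2]⟩
  · intro ha
    have hmem : 2 * a ∈ Icc (-derivWithin (dWaveSourceEnergyDensityTT' t' U μ) (Iio h) h)
        (-derivWithin (dWaveSourceEnergyDensityTT' t' U μ) (Ioi h) h) :=
      ⟨by linarith [ha.1], by linarith [ha.2]⟩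
    obtain ⟨ω, hω, hωa⟩ := key.symm.subset hmem
    exact ⟨ω, hω, by simp only at hωa; linarith⟩

/-- Pointwise form: every `a ∈ [−∂⁻E(h)/2, −∂⁺E(h)/2]` is the pair amplitude `Re ω(P₀^d)` of some
translation-invariant ground state of `Ψ_h`. [cite: Griffiths1966, §II] -/
theorem exists_isMeanEnergyMinimiser_re_expect_localPairAt_eq {t' U μ h a : ℝ}
    (ha : a ∈ Icc (-derivWithin (dWaveSourceEnergyDensityTT' t' U μ) (Iio h) h / 2)
      (-derivWithin (dWaveSourceEnergyDensityTT' t' U μ) (Ioi h) h / 2)) :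
    ∃ ω : InfVolFermionState 2,
      ω.IsMeanEnergyMinimiser (hubbardTTPrimeSourcedInteraction 1 t' U μ dWaveFormFactor h) 1 ∧
        (ω.expect (pairRegion (insert (0 : Site 2) unitSteps) 0)
          (localPairAt (insert 0 unitSteps) dWaveFormFactor 0)).re = a := by
  obtain ⟨ω, hω, hωa⟩ := (image_re_expect_localPairAt_minimisers_eq_Icc t' U μ h).symm.subset ha
  exact ⟨ω, hω, hωa⟩

/-- **At zero field**: the REAL parts of the pair amplitudes of the translation-invariant ground states of the
grand-canonical `t–t'` interaction fill `[−m⋆, m⋆]`, `m⋆ = dWaveOrderParameterTT' t' U μ = −∂⁺E(0)/2 = ∂⁻E(0)/2`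
(`E` is even). [cite: KomaTasaki1994, §1] -/
theorem image_re_expect_localPairAt_minimisers_zero_eq_Icc (t' U μ : ℝ) :
    (fun ω : InfVolFermionState 2 => (ω.expect (pairRegion (insert (0 : Site 2) unitSteps) 0)
        (localPairAt (insert 0 unitSteps) dWaveFormFactor 0)).re) ''
        {ω | ω.IsMeanEnergyMinimiser (hubbardTTPrimeMuInteraction 1 t' U μ) 1} =
      Icc (-dWaveOrderParameterTT' t' U μ) (dWaveOrderParameterTT' t' U μ) := by
  have key := image_re_expect_localPairAt_minimisers_eq_Icc t' U μ 0
  rw [hubbardTTPrimeSourcedInteraction_zero_source] at key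
  rw [key, dWaveOrderParameterTT'_eq_neg_half_rightDeriv, leftDeriv_dWaveSourceEnergyDensityTT'_zero,
    dWaveOrderParameterTT'_eq_neg_half_rightDeriv]
  congr 1; ring

end DWave

end Literature.MathematicalPhysics.QuantumLattice

end
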